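import Mathlib.Analysis.Distribution.SchwartzSpace.Fourier
import Mathlib.Analysis.Fourier.Inversion
import Mathlib.Analysis.SpecialFunctions.Integrals.Basic
import Literature.NumberTheory.ConnesConsani2021.ArchimedeanTraceFormula
import HarnessLib

/-!
# The kernel of the quantized differential `[H, f]` through the Fourier transform of `f`:
# `k_f(s,t) = (i/π)(f(s) − f(t))/(s − t) = −2 ∫ f̂(u) ∫₀ᵘ e^{2πi(sξ − t(ξ−u))} dξ du` (App. D/E of CC 2021)

RH-FREE analysis (cell `rh-crit`, sub-cell cc, seat t13; a brick of the planned discharge of the tree fact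
`CC2021_lemma_D47`, App. D Lemma D.1 (47): "`[H,f] = 𝔽_C[1_P, K]𝔽_C⁻¹`" (p0033:L24), i.e. the position kernel
`k_f` of App. E (quantdiff) is the Fourier conjugate of a kernel living on the off-diagonal frequency quadrants —
here the two elementary identities that carry that conjugation: Fourier inversion for `f ∈ 𝒮` written as
`f(s) − f(t) = ∫ f̂(u)(e^{2πius} − e^{2πiut}) du`, and the oscillatory interval integral
`∫₀ᵘ e^{2πi(sξ − t(ξ−u))}dξ = (e^{2πisu} − e^{2πitu})/(2πi(s−t))` whose `(u, ξ) ↦ (ξ, ξ−u)` image is the quadrant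
`{ξ > 0 > η}` (and `{ξ < 0 < η}` for `u < 0`)); pass 2 carries the substitution out:
`quantizedDiffKernel_eq_integral_integral_quadrant` — `k_f(s,t) = −2∫_ξ∫_η f̂(ξ−η)(1_{ξ>0≥η} − 1_{ξ≤0<η})
e^{2πi(sξ−tη)} dη dξ` (Fubini on `ℝ²`, dominated by `‖f̂(u)‖1_{|ξ|≤|u|}`), i.e. `k_f` is the inverse-Fourier
conjugate of the frequency kernel `−(sgn ξ − sgn η) f̂(ξ − η)`.  WHAT THIS IS NOT: any claim about RH.
Theorems only (net debt 0).
-/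

noncomputable section

open MeasureTheory Complex Set
open scoped Real FourierTransform

namespace Literature.NumberTheory.ConnesConsani2021

/-- RH-FREE. **The oscillatory interval integral**: for `s ≠ t`,
`∫₀ᵘ e^{2πi(sξ − t(ξ − u))} dξ = (e^{2πisu} − e^{2πitu}) / (2πi(s − t))`.
[cite: ConnesConsani2021, App. D p. 33 (arXiv chunk p0033:L24: `[H,f] = 𝔽_C[1_P,K]𝔽_C⁻¹`); App. E eq. (quantdiff) p. 34] -/
theorem intervalIntegral_cexp_two_pi_mul_I {s t : ℝ} (hst : s ≠ t) (u : ℝ) :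
    ∫ ξ in (0:ℝ)..u, cexp (2 * π * I * (s * ξ - t * (ξ - u))) =
      (cexp (2 * π * I * (u * s)) - cexp (2 * π * I * (u * t))) / (2 * π * I * (s - t)) := by
  have hc : (2 * π * I * ((s : ℂ) - t)) ≠ 0 := by
    refine mul_ne_zero (mul_ne_zero (mul_ne_zero two_ne_zero ?_) I_ne_zero) ?_
    · exact_mod_cast Real.pi_ne_zero
    · exact sub_ne_zero.2 (by exact_mod_cast hst)
  have h1 : ∀ ξ : ℝ, cexp (2 * π * I * (s * ξ - t * (ξ - u))) =
      cexp (2 * π * I * (u * t)) * cexp ((2 * π * I * (s - t)) * ξ) := by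
    intro ξ; rw [← Complex.exp_add]; congr 1; ring
  simp_rw [h1]
  rw [intervalIntegral.integral_const_mul, integral_exp_mul_complex hc, ofReal_zero, mul_zero,
    Complex.exp_zero, ← mul_div_assoc, mul_sub, mul_one, ← Complex.exp_add]
  have hexp : 2 * (π : ℂ) * I * ((u : ℂ) * t) + 2 * π * I * ((s : ℂ) - t) * (u : ℂ) =
      2 * π * I * ((u : ℂ) * s) := by ring
  rw [hexp]

/-- RH-FREE. **Fourier inversion for a Schwartz function, in the form used for `[H, f]`**:
`f(x) = ∫ f̂(u) e^{2πiux} du` (`f̂ = 𝓕f`, Mathlib's kernel `e^{−2πiux}`).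
[cite: ConnesConsani2021, App. D p. 33 (arXiv chunk p0033:L24–26: `K = 𝔽_C⁻¹ f 𝔽_C`, `f ∈ 𝒮(Ĉ)`)] -/
theorem schwartz_eq_integral_fourier_mul_cexp (f : SchwartzMap ℝ ℂ) (x : ℝ) :
    (f : ℝ → ℂ) x = ∫ u : ℝ, 𝓕 (f : ℝ → ℂ) u * cexp (2 * π * I * (u * x)) := by
  have hint : Integrable (𝓕 (f : ℝ → ℂ)) := by
    simpa [SchwartzMap.fourier_coe] using (𝓕 f).integrable
  have h := congrFun (f.continuous.fourierInv_fourier_eq f.integrable hint) x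
  rw [← h, Real.fourierInv_eq']
  refine integral_congr_ae (Filter.Eventually.of_forall fun v => ?_)
  simp only [smul_eq_mul, mul_comm (𝓕 (f : ℝ → ℂ) v)]
  congr 1
  simp only [RCLike.inner_apply, conj_trivial]
  push_cast
  ring_nf

/-- RH-FREE. The integrand `f̂(u)e^{2πiux}` is integrable (`f̂ ∈ 𝒮`, `|e^{2πiux}| = 1`). [folklore] -/
private theorem integrable_fourier_mul_cexp (f : SchwartzMap ℝ ℂ) (x : ℝ) :
    Integrable fun u : ℝ => 𝓕 (f : ℝ → ℂ) u * cexp (2 * π * I * (u * x)) := by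
  have hint : Integrable (𝓕 (f : ℝ → ℂ)) := by
    simpa [SchwartzMap.fourier_coe] using (𝓕 f).integrable
  refine (hint.mul_bdd (c := 1) ?_ ?_)
  · exact (by fun_prop : Continuous fun u : ℝ => cexp (2 * π * I * (u * x))).aestronglyMeasurable
  · refine Filter.Eventually.of_forall fun u => ?_
    rw [Complex.norm_exp]
    simp

/-- RH-FREE. **`k_f` through `f̂`**: for `s ≠ t`,
`(i/π)(f(s) − f(t))/(s − t) = (i/π)(∫ f̂(u)(e^{2πius} − e^{2πiut}) du)/(s − t)`.
[cite: ConnesConsani2021, App. E eq. (quantdiff) p. 34 (arXiv chunk p0034:L21–22); App. D p. 33 (chunk p0033:L24–26)] -/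
theorem quantizedDiffKernel_eq_integral_fourier (f : SchwartzMap ℝ ℂ) (s t : ℝ) :
    quantizedDiffKernel f s t =
      I / π * ((∫ u : ℝ, 𝓕 (f : ℝ → ℂ) u *
        (cexp (2 * π * I * (u * s)) - cexp (2 * π * I * (u * t)))) / ((s : ℂ) - t)) := by
  unfold quantizedDiffKernel
  rw [schwartz_eq_integral_fourier_mul_cexp f s, schwartz_eq_integral_fourier_mul_cexp f t,
    ← integral_sub (integrable_fourier_mul_cexp f s) (integrable_fourier_mul_cexp f t)]
  congr 2
  refine integral_congr_ae (Filter.Eventually.of_forall fun u => ?_)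
  simp only
  ring

/-- RH-FREE. **`k_f` as a superposition of the oscillatory interval integrals**: for `s ≠ t`,
`k_f(s,t) = −2 ∫ f̂(u) (∫₀ᵘ e^{2πi(sξ − t(ξ−u))} dξ) du` — substituting `η = ξ − u`, the inner domain
`{0 < ξ < u} ∪ {u < ξ < 0}` becomes the off-diagonal quadrants `{ξ > 0 > η} ∪ {ξ < 0 < η}` with the weight
`−(sgn ξ − sgn η) f̂(ξ − η)`: the frequency-side kernel of `[H, f]`.
[cite: ConnesConsani2021, App. D Lemma 47 proof p. 33 (arXiv chunk p0033:L24–36)] -/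
theorem quantizedDiffKernel_eq_integral_intervalIntegral (f : SchwartzMap ℝ ℂ) {s t : ℝ} (hst : s ≠ t) :
    quantizedDiffKernel f s t =
      -2 * ∫ u : ℝ, 𝓕 (f : ℝ → ℂ) u * ∫ ξ in (0:ℝ)..u, cexp (2 * π * I * (s * ξ - t * (ξ - u))) := by
  rw [quantizedDiffKernel_eq_integral_fourier f s t]
  simp_rw [intervalIntegral_cexp_two_pi_mul_I hst]
  have hrw : ∀ u : ℝ, 𝓕 (f : ℝ → ℂ) u *
      ((cexp (2 * π * I * (u * s)) - cexp (2 * π * I * (u * t))) / (2 * π * I * (s - t))) =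
      (2 * π * I * ((s : ℂ) - t))⁻¹ *
        (𝓕 (f : ℝ → ℂ) u * (cexp (2 * π * I * (u * s)) - cexp (2 * π * I * (u * t)))) := by
    intro u
    rw [div_eq_mul_inv]
    ring
  simp_rw [hrw]
  rw [integral_const_mul]
  set X := ∫ u : ℝ, 𝓕 (f : ℝ → ℂ) u * (cexp (2 * π * I * (u * s)) - cexp (2 * π * I * (u * t)))
    with hX
  have key : I / (π : ℂ) * ((s : ℂ) - t)⁻¹ = -2 * (2 * π * I * ((s : ℂ) - t))⁻¹ := by
    simp only [mul_inv, Complex.inv_I]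
    ring
  rw [div_eq_mul_inv X, show I / (π : ℂ) * (X * ((s : ℂ) - t)⁻¹) = (I / π * ((s : ℂ) - t)⁻¹) * X by ring,
    key]
  ring

/-! ## The frequency-side kernel: `k_f(s,t) = −2∫∫ f̂(ξ−η) W(ξ,η) e^{2πi(sξ − tη)} dη dξ`, `W = 1_{ξ>0≥η} − 1_{ξ≤0<η}` -/

/-- RH-FREE. The signed window of the substitution `η = ξ − u`: `1_{(0,u]}(ξ) − 1_{(u,0]}(ξ)` at `u = ξ − η` is
`1_{ξ>0, η≤0} − 1_{ξ≤0, η>0}` — the off-diagonal frequency quadrants of `[1_P, K]` (App. D p. 33).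
[cite: ConnesConsani2021, App. D Lemma 47 proof p. 33 (arXiv chunk p0033:L24–36)] -/
theorem quadrantWindow_eq (ξ η : ℝ) :
    ((if 0 < ξ ∧ ξ ≤ ξ - η then (1 : ℂ) else 0) - (if ξ - η < ξ ∧ ξ ≤ 0 then (1 : ℂ) else 0)) =
      (if 0 < ξ ∧ η ≤ 0 then (1 : ℂ) else 0) - (if ξ ≤ 0 ∧ 0 < η then (1 : ℂ) else 0) := by
  have h1 : (0 < ξ ∧ ξ ≤ ξ - η) ↔ (0 < ξ ∧ η ≤ 0) := by constructor <;> rintro ⟨a, b⟩ <;> exact ⟨a, by linarith⟩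
  have h2 : (ξ - η < ξ ∧ ξ ≤ 0) ↔ (ξ ≤ 0 ∧ 0 < η) := by
    constructor <;> rintro ⟨a, b⟩
    · exact ⟨b, by linarith⟩
    · exact ⟨by linarith, a⟩
  simp only [h1, h2]

/-- RH-FREE. The interval integral `∫₀ᵘ` as an integral against the signed window `1_{(0,u]} − 1_{(u,0]}`.
[folklore] -/
private theorem intervalIntegral_eq_integral_window (g : ℝ → ℂ) (hg : Continuous g) (u : ℝ) :
    ∫ ξ in (0:ℝ)..u, g ξ =
      ∫ ξ : ℝ, ((if 0 < ξ ∧ ξ ≤ u then (1 : ℂ) else 0) - (if u < ξ ∧ ξ ≤ 0 then (1 : ℂ) else 0)) * g ξ := by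
  have hI : ∀ a b : ℝ, ∫ ξ in Ioc a b, g ξ = ∫ ξ : ℝ, (if a < ξ ∧ ξ ≤ b then (1 : ℂ) else 0) * g ξ := by
    intro a b
    rw [← integral_indicator measurableSet_Ioc]
    refine integral_congr_ae (Filter.Eventually.of_forall fun ξ => ?_)
    simp only [Set.indicator_apply, Set.mem_Ioc, boole_mul]
  have hint : ∀ a b : ℝ, Integrable (fun ξ : ℝ => (if a < ξ ∧ ξ ≤ b then (1 : ℂ) else 0) * g ξ) := by
    intro a b
    have h : (fun ξ : ℝ => (if a < ξ ∧ ξ ≤ b then (1 : ℂ) else 0) * g ξ) = (Ioc a b).indicator g := by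
      funext ξ; simp only [Set.indicator_apply, Set.mem_Ioc, boole_mul]
    rw [h, integrable_indicator_iff measurableSet_Ioc]
    exact (hg.integrableOn_Icc (a := a) (b := b)).mono_set Ioc_subset_Icc_self
  simp only [intervalIntegral, hI]
  rw [← integral_sub (hint 0 u) (hint u 0)]
  refine integral_congr_ae (Filter.Eventually.of_forall fun ξ => ?_)
  ring

/-- RH-FREE. **The kernel of `[H, f]` as a double frequency integral over the off-diagonal quadrants**:
for `s ≠ t`,
`k_f(s,t) = −2 ∫_ξ ∫_η f̂(ξ−η)·(1_{ξ>0,η≤0} − 1_{ξ≤0,η>0})·e^{2πi(sξ − tη)} dη dξ`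
— i.e. `k_f` is the inverse Fourier conjugate of the frequency kernel `b(ξ,η) = −(sgn ξ − sgn η) f̂(ξ − η)`
supported where `|ξ − η| = |ξ| + |η|` (App. D: "`[H, f] = 𝔽_C[1_P, K]𝔽_C⁻¹`", `K = 𝔽_C⁻¹ f 𝔽_C` the convolution
by `f̂`).  [cite: ConnesConsani2021, App. D Lemma 47 proof p. 33 (arXiv chunk p0033:L24–36); App. E eq. (quantdiff) p. 34] -/
theorem quantizedDiffKernel_eq_integral_integral_quadrant (f : SchwartzMap ℝ ℂ) {s t : ℝ} (hst : s ≠ t) :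
    quantizedDiffKernel f s t =
      -2 * ∫ ξ : ℝ, ∫ η : ℝ, 𝓕 (f : ℝ → ℂ) (ξ - η) *
        (((if 0 < ξ ∧ η ≤ 0 then (1 : ℂ) else 0) - (if ξ ≤ 0 ∧ 0 < η then (1 : ℂ) else 0)) *
          cexp (2 * π * I * (s * ξ - t * η))) := by
  rw [quantizedDiffKernel_eq_integral_intervalIntegral f hst]
  congr 1
  -- Step 1: the inner interval integral against the signed window
  have hcont : ∀ u : ℝ, Continuous fun ξ : ℝ => cexp (2 * π * I * (s * ξ - t * (ξ - u))) := by
    intro u; fun_prop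
  have hwin : ∀ u : ℝ, (∫ ξ in (0:ℝ)..u, cexp (2 * π * I * (s * ξ - t * (ξ - u)))) =
      ∫ ξ : ℝ, ((if 0 < ξ ∧ ξ ≤ u then (1 : ℂ) else 0) - (if u < ξ ∧ ξ ≤ 0 then (1 : ℂ) else 0)) *
        cexp (2 * π * I * (s * ξ - t * (ξ - u))) := fun u => intervalIntegral_eq_integral_window _ (hcont u) u
  simp_rw [hwin, ← integral_const_mul]
  -- Step 2: Fubini on `ℝ × ℝ` for `G(u, ξ) = f̂(u) W(u, ξ) e(ξ, u)`, dominated by `‖f̂(u)‖ 1_{|ξ| ≤ |u|}`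
  set G : ℝ → ℝ → ℂ := fun u ξ => 𝓕 (f : ℝ → ℂ) u *
    (((if 0 < ξ ∧ ξ ≤ u then (1 : ℂ) else 0) - (if u < ξ ∧ ξ ≤ 0 then (1 : ℂ) else 0)) *
      cexp (2 * π * I * (s * ξ - t * (ξ - u)))) with hG
  have hFint : Integrable (𝓕 (f : ℝ → ℂ)) := by
    simpa [SchwartzMap.fourier_coe] using (𝓕 f).integrable
  have hFcont : Continuous (𝓕 (f : ℝ → ℂ)) := by
    simpa [SchwartzMap.fourier_coe] using (𝓕 f).continuous
  have hF1 : Integrable (fun u : ℝ => |u| * ‖𝓕 (f : ℝ → ℂ) u‖) := by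
    have h := (𝓕 f).integrable_pow_mul (volume : Measure ℝ) 1
    refine (integrable_congr (Filter.Eventually.of_forall fun x => ?_)).1 h
    rw [pow_one, Real.norm_eq_abs,
      show ((𝓕 f : SchwartzMap ℝ ℂ) : ℝ → ℂ) x = 𝓕 (f : ℝ → ℂ) x from
        congrFun (SchwartzMap.fourier_coe f) x]
  have hmeasW : Measurable fun p : ℝ × ℝ =>
      ((if 0 < p.2 ∧ p.2 ≤ p.1 then (1 : ℂ) else 0) - (if p.1 < p.2 ∧ p.2 ≤ 0 then (1 : ℂ) else 0)) := by
    refine Measurable.sub ?_ ?_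
    · refine Measurable.ite ?_ measurable_const measurable_const
      exact (measurableSet_lt measurable_const measurable_snd).inter
        (measurableSet_le measurable_snd measurable_fst)
    · refine Measurable.ite ?_ measurable_const measurable_const
      exact (measurableSet_lt measurable_fst measurable_snd).inter
        (measurableSet_le measurable_snd measurable_const)
  have hGmeas : AEStronglyMeasurable (Function.uncurry G) (volume.prod volume) := by
    refine Measurable.aestronglyMeasurable ?_
    refine ((hFcont.measurable.comp measurable_fst).mul (hmeasW.mul ?_))
    exact (by fun_prop : Continuous fun p : ℝ × ℝ =>
      cexp (2 * π * I * (s * p.2 - t * (p.2 - p.1)))).measurable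
  have hbound : ∀ u ξ : ℝ, ‖G u ξ‖ ≤ ‖𝓕 (f : ℝ → ℂ) u‖ * (Icc (-|u|) |u|).indicator (fun _ => (1 : ℝ)) ξ := by
    intro u ξ
    simp only [hG, norm_mul]
    have he : ‖cexp (2 * π * I * (s * ξ - t * (ξ - u)))‖ = 1 := by
      rw [Complex.norm_exp]; simp
    by_cases hξ : ξ ∈ Icc (-|u|) |u|
    · rw [Set.indicator_of_mem hξ, mul_one]
      refine mul_le_of_le_one_right (norm_nonneg _) ?_
      rw [he, mul_one]
      split_ifs <;> simp
    · have hA : ¬ (0 < ξ ∧ ξ ≤ u) := fun h =>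
        hξ (Set.mem_Icc.2 ⟨by linarith [abs_nonneg u, h.1], h.2.trans (le_abs_self u)⟩)
      have hB : ¬ (u < ξ ∧ ξ ≤ 0) := fun h =>
        hξ (Set.mem_Icc.2 ⟨by linarith [neg_abs_le u, h.1], h.2.trans (abs_nonneg u)⟩)
      simp [if_neg hA, if_neg hB, Set.indicator_of_notMem hξ]
  have hGint : Integrable (Function.uncurry G) (volume.prod volume) := by
    refine Integrable.mono' (f := Function.uncurry G)
      (g := fun p : ℝ × ℝ => ‖𝓕 (f : ℝ → ℂ) p.1‖ * (Icc (-|p.1|) |p.1|).indicator (fun _ => (1 : ℝ)) p.2)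
      ?_ hGmeas (Filter.Eventually.of_forall fun p => hbound p.1 p.2)
    -- integrability of the dominating function: sections and `∫ = 2|u| ‖f̂ u‖`
    have hmeas2 : AEStronglyMeasurable (fun p : ℝ × ℝ =>
        ‖𝓕 (f : ℝ → ℂ) p.1‖ * (Icc (-|p.1|) |p.1|).indicator (fun _ => (1 : ℝ)) p.2) (volume.prod volume) := by
      refine Measurable.aestronglyMeasurable ((hFcont.measurable.comp measurable_fst).norm.mul ?_)
      have hset : MeasurableSet {p : ℝ × ℝ | p.2 ∈ Icc (-|p.1|) |p.1|} :=
        (measurableSet_le (measurable_fst.abs.neg) measurable_snd).inter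
          (measurableSet_le measurable_snd measurable_fst.abs)
      exact (measurable_const.indicator hset : Measurable fun p : ℝ × ℝ =>
        Set.indicator {p : ℝ × ℝ | p.2 ∈ Icc (-|p.1|) |p.1|} (fun _ => (1 : ℝ)) p)
    rw [integrable_prod_iff hmeas2]
    constructor
    · refine Filter.Eventually.of_forall fun u => ?_
      have h1 : Integrable ((Icc (-|u|) |u|).indicator fun _ : ℝ => (1 : ℝ)) (volume : Measure ℝ) :=
        (integrable_indicator_iff measurableSet_Icc).2 continuous_const.integrableOn_Icc
      simpa using h1.const_mul ‖𝓕 (f : ℝ → ℂ) u‖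
    · have heq : (fun u : ℝ => ∫ ξ : ℝ, ‖‖𝓕 (f : ℝ → ℂ) u‖ *
          (Icc (-|u|) |u|).indicator (fun _ => (1 : ℝ)) ξ‖) = fun u => |u| * ‖𝓕 (f : ℝ → ℂ) u‖ * 2 := by
        funext u
        have hnn : ∀ ξ, 0 ≤ ‖𝓕 (f : ℝ → ℂ) u‖ * (Icc (-|u|) |u|).indicator (fun _ => (1 : ℝ)) ξ := fun ξ =>
          mul_nonneg (norm_nonneg _) (Set.indicator_nonneg (fun _ _ => zero_le_one) _)
        simp_rw [Real.norm_of_nonneg (hnn _)]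
        rw [integral_const_mul, integral_indicator_const _ measurableSet_Icc, smul_eq_mul, mul_one,
          Real.volume_real_Icc_of_le (by linarith [abs_nonneg u])]
        ring
      rw [heq]
      exact hF1.mul_const 2
  -- Step 3: swap, substitute `u = ξ − η`, simplify the phase
  rw [integral_integral_swap hGint]
  refine integral_congr_ae (Filter.Eventually.of_forall fun ξ => ?_)
  dsimp only
  rw [← integral_sub_left_eq_self (fun u => G u ξ) volume ξ]
  refine integral_congr_ae (Filter.Eventually.of_forall fun η => ?_)
  simp only [hG, quadrantWindow_eq]
  have hAB : cexp (2 * π * I * (s * ξ - t * (ξ - ((ξ - η : ℝ) : ℂ)))) =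
      cexp (2 * π * I * (s * ξ - t * η)) := by
    push_cast; congr 1; ring
  rw [hAB]

end Literature.NumberTheory.ConnesConsani2021
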